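import Summits.Langlands.Langlands.Theorems.IrreducibilityBySelfDualityIrreducibleOffSectorOfReciprocity
import Summits.Langlands.Langlands.Theorems.IrreducibilityBySelfDualityReciprocityUpToIrreducibilityIsobaricRigidity
import Summits.Langlands.Langlands.Theorems.IrreducibilityBySelfDualityReciprocityUpToIrreducibilityDeRhamBlocks
import Summits.Langlands.Langlands.Theorems.IrreducibilityBySelfDualityReciprocityUpToIrreducibilityGeometricConstituents
import Literature.NumberTheory.Automorphic.ChebotarevArtinRepHolds
import Literature.NumberTheory.GaloisRepresentations.FramedRepEquivConj
import Literature.NumberTheory.Automorphic.IsAutomorphicAE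
import Literature.NumberTheory.Automorphic.GLnAdelicStructureProofs
import HarnessLib

/-!
# The summit's certified seam `W → B_w → LGC → JS (2.2) → JS (2.3) → Langlands`, RE-GLUED for the
re-typed summit (`∀ 𝓡` + non-vacuity; operator p141787, 2026-08-17) — STRUCTURAL
(crux stmt-Langlands-18275 `EisensteinGelfandKirillov.SectorComplement`, line `Sketch-18275-r1-k1`;
`--supports` file; imports `Summits.Langlands.Statement` + landed Theses-free modules + Literature only)

On 2026-08-17 the summit statement was re-typed (semantic-vacuity audit §2.11 row B, human-approved):

  `Langlands := ∀ F, Nonempty (ReciprocityData F) ∧ ∀ (𝓡 : ReciprocityData F) (n > 0) hcpt, (A) ∧ (B)`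

— the correspondence is demanded for ALL reciprocity data `𝓡`, no longer for prover-chosen ones
(`∃ 𝓡`).  The landed structural decoupling
`IrreducibleOffSector.langlands_of_reciprocityUpToIrreducibility_text_of_JS` (p115588) and every frame
line composed through it (`Cruxes/SectorToLanglands/Lines/SectorToLanglandsOfLeaves.lean`,
`Cruxes/SectorComplement/Lines/{birth, birth_MirrorPairReflection, Sketch_18275_r1_k1}.lean`) take the
local–global-compatibility leaf in the `∃ Rec` form and therefore no longer reach the summit.  This file
re-glues the seam for the new statement, with the two honest changes the re-type forces:

* LGC becomes **LGC∀** — local–global compatibility at every finite place for irreducible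
  pinned-geometric a.e.-compatible pairs, for EVERY reciprocity datum `Rec` (Henniart-normalised data
  all give the same clause on generic classes in print; in the tree this is the content of the pin
  `ReciprocityData.llc_isCanonical`);
* a sixth leaf **RD** — `∀ K, Nonempty (ReciprocityData K)`: a local Langlands datum for `GL_n(K_v)`
  at every finite place with THE canonical local Artin map (Harris–Taylor 2001 Thm. A / Henniart 2000
  + local class field theory; the summit's non-vacuity conjunct).

Theorems (no definitions; axioms `propext`, `Classical.choice`, `Quot.sound`):

* `langlands_of_reciprocityUpToIrreducibility_forall_text_of_JS` — (2.2) ∧ (2.3) ∧ RD ∧ "reciprocity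
  up to irreducibility for every `Rec`" ⇒ `Langlands`: clause (B) is given; in clause (A) the avatar is
  irreducible — as is EVERY a.e.-compatible `ρ'` — by the landed isobaric bootstrap
  `isIrreducible_of_reciprocityUpToIrreducibility` (p103935), and uniqueness up to conjugacy is
  Chebotarev + Brauer–Nesbitt on semisimple (because irreducible) avatars with equal Frobenius
  polynomials a.e. (verbatim the argument of p115588, now inside `∀ 𝓡`);
* `langlands_of_weak_leaves_forall` — **W → B_w → LGC∀ → JS (2.2) → JS (2.3) → RD → Langlands**: the
  isobaric bootstrap run with B_w (irreducibility of W's avatar: geometric constituents p99702 + de Rham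
  heredity p98936, B_w on the constituents, Jacquet–Shalika rigidity p105601), the packaging of
  reciprocity-up-to-irreducibility for each `Rec`, then the previous theorem.

References: K. Buzzard, T. Gee, LMS LNS 414 (2014), Conj. 3.2.1–3.2.2 [BuzzardGeeLMS2014]; J.-M. Fontaine,
B. Mazur (1995), Conj. 1 [FontaineMazurGeometric1995]; J. Arthur, L. Clozel, Ann. Math. Stud. 120, Ch. 3 §2
(2.2)–(2.3) [ArthurClozelAMS120]; F. Calegari, T. Gee, Ann. Inst. Fourier 63 (2013) §1.1 [CalegariGee2013];
P. Deligne, J.-P. Serre, ASENS 7 (1974), Lemme 3.2 [DeligneSerreASENS1974]; M. Harris, R. Taylor, Ann. Math.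
Stud. 151 (2001), Thm. A [HarrisTaylorAMS2001].
-/

noncomputable section

set_option linter.dupNamespace false -- project-wide option; `Summit.Langlands.Langlands` is the mandated namespace

open scoped NumberField Classical Polynomial
open Filter IsDedekindDomain Polynomial
open Literature.NumberTheory.Automorphic Literature.NumberTheory.GaloisRepresentations
open Summit.Langlands
open Summit.Langlands.Langlands.Theorems.ReciprocityUpToIrreducibility
open Summit.Langlands.Langlands.Theorems.IrreducibleOffSector

namespace Summit.Langlands.Langlands.Theorems.SectorComplementSeam

/-- **`Langlands` (re-typed, `∀ 𝓡`) from reciprocity up to irreducibility for EVERY reciprocity datum,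
Arthur–Clozel (2.2)–(2.3) for Borel–Jacquet data, and the non-vacuity leaf RD.**  For each `𝓡`: clause
(B) is given; clause (A)'s avatar — and every a.e.-compatible `ρ'` — is irreducible by the isobaric
bootstrap (`isIrreducible_of_reciprocityUpToIrreducibility`), hence semisimple, and two corresponding
avatars have equal Satake parameters a.e. (`hasSatakeParamAt_unique_holds`), so equal Frobenius
polynomials a.e., so are equivalent (Chebotarev + Brauer–Nesbitt,
`FramedGaloisRep.nonempty_equiv_of_hasFrobCharpolyAt_eventually chebotarev_artinRep_holds`), so
conjugate (`FramedRep.exists_eq_conj_of_equiv`). [cite: CalegariGee2013, §1.1]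
[cite: BuzzardGeeLMS2014, Conj. 3.2.1 and Conj. 3.2.2] [cite: DeligneSerreASENS1974, Lemme 3.2] -/
theorem langlands_of_reciprocityUpToIrreducibility_forall_text_of_JS
    (h22 : JacquetShalika1981_partialPairL_boundary_repData)
    (h23 : JacquetShalika1981_partialPairL_pole_repData)
    (hne : ∀ (F : Type) [Field F] [NumberField F], Nonempty (ReciprocityData F))
    (cE : ∀ (F : Type) [Field F] [NumberField F] (Rec : ReciprocityData F) (n : ℕ), 0 < n →
      ∀ hcpt : isCompact_glFiniteIntegralLevel n F,
        (∀ π : CuspidalAutomorphicRepData n F hcpt, π.1.IsLAlgebraic →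
          ∀ (ℓ : ℕ) [Fact ℓ.Prime] (ι : PadicAlgCl ℓ ≃+* ℂ),
            ∃ ρ : FramedGaloisRep F (PadicAlgCl ℓ) n, IsGeometricFramed Rec ρ ∧ Corresponds Rec ι π.1 ρ) ∧
        GaloisToAutomorphic n Rec hcpt) :
    _root_.Langlands := by
  intro F _ _
  refine ⟨hne F, fun Rec n hn hcpt => ?_⟩
  have hRec := fun n hn hcpt => cE F Rec n hn hcpt
  obtain ⟨hA, hB⟩ := cE F Rec n hn hcpt
  refine ⟨?_, hB⟩
  intro π hL ℓ _ ι
  -- irreducibility of EVERY avatar Satake–Frobenius compatible a.e. with `π`: the isobaric bootstrap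
  have irr : ∀ ρ : FramedGaloisRep F (PadicAlgCl ℓ) n,
      (∀ᶠ v : HeightOneSpectrum (𝓞 F) in cofinite, SatakeFrobCompatibleAt ι π.1 ρ v) →
        ρ.toGaloisRep.IsIrreducible :=
    fun ρ hρ => isIrreducible_of_reciprocityUpToIrreducibility h22 h23 hRec hcpt hn π hL ι ρ hρ
  obtain ⟨ρ, hgeo, hcorr⟩ := hA π hL ℓ ι
  refine ⟨ρ, irr ρ hcorr.1, hgeo, hcorr, fun ρ' hcorr' => ?_⟩
  -- uniqueness up to conjugacy: irreducible ⇒ semisimple; equal Satake parameters a.e.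
  -- ⇒ equal Frobenius polynomials a.e. ⇒ equivalent (Chebotarev + Brauer–Nesbitt) ⇒ conjugate
  have h1 : ρ.toGaloisRep.IsIrreducible := irr ρ hcorr.1
  have h2 : ρ'.toGaloisRep.IsIrreducible := irr ρ' hcorr'.1
  have hs1 : ρ.toGaloisRep.IsSemisimple := by
    haveI := h1
    change ComplementedLattice _
    infer_instance
  have hs2 : ρ'.toGaloisRep.IsSemisimple := by
    haveI := h2
    change ComplementedLattice _
    infer_instance
  have hev : ∀ᶠ v : HeightOneSpectrum (𝓞 F) in cofinite,
      ρ.IsUnramifiedAt v ∧ ρ'.IsUnramifiedAt v ∧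
        ∃ P : Polynomial (PadicAlgCl ℓ), ρ.HasFrobCharpolyAt v P ∧ ρ'.HasFrobCharpolyAt v P := by
    filter_upwards [hcorr.1, hcorr'.1] with v hv hv'
    obtain ⟨α, hα, hur, hcp⟩ := hv
    obtain ⟨α', hα', hur', hcp'⟩ := hv'
    obtain rfl : α = α' := AutomorphicRepData.hasSatakeParamAt_unique_holds π.1 hα hα'
    exact ⟨hur, hur', _, hcp, hcp'⟩
  obtain ⟨e⟩ := FramedGaloisRep.nonempty_equiv_of_hasFrobCharpolyAt_eventually
    chebotarev_artinRep_holds ρ ρ' hs1 hs2 hev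
  obtain ⟨P, hP⟩ := FramedRep.exists_eq_conj_of_equiv ρ ρ' e
  exact ⟨P, hP.symm⟩

/-- **The re-glued seam: W → B_w → LGC∀ → JS (2.2) → JS (2.3) → RD → `Langlands`** (leaf texts: W and
B_w verbatim the registered stubs `stub_weakExistence` / `stub_fontaineMazurLanglandsGLn`-unfolded of the
frame lines; LGC∀ = local–global compatibility for EVERY `Rec`; RD = non-vacuity of `ReciprocityData`).
Proof: the isobaric bootstrap run with B_w (a pinned-geometric avatar of a cuspidal `π` is irreducible:
geometric constituents + de Rham heredity, B_w on the constituents, Jacquet–Shalika rigidity), the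
packaging of reciprocity up to irreducibility for each `Rec`, then
`langlands_of_reciprocityUpToIrreducibility_forall_text_of_JS`. [cite: BuzzardGeeLMS2014, Conj. 3.2.1 and Conj. 3.2.2]
[cite: ArthurClozelAMS120, Ch. 3 §2 (2.2)–(2.3)] [cite: FontaineMazurGeometric1995, Conj. 1]
[cite: HarrisTaylorAMS2001, Thm. A] -/
theorem langlands_of_weak_leaves_forall
    (hW : ∀ (K : Type) [Field K] [NumberField K] (n : ℕ) (hcpt : isCompact_glFiniteIntegralLevel n K),
      0 < n → ∀ π : CuspidalAutomorphicRepData n K hcpt, π.1.IsLAlgebraic → ∀ (ℓ : ℕ) [Fact ℓ.Prime]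
      (ι : PadicAlgCl ℓ ≃+* ℂ), ∃ ρ : FramedGaloisRep K (PadicAlgCl ℓ) n,
      ((∀ᶠ v : HeightOneSpectrum (𝓞 K) in cofinite, ρ.IsUnramifiedAt v) ∧
        ∀ (v : HeightOneSpectrum (𝓞 K)) (hv : ((ℓ : ℕ) : 𝓞 K) ∈ v.asIdeal),
          (Literature.NumberTheory.PAdicHodge.fontainePstAdicCompletion v ℓ hv).IsDeRhamFramed (ρ.toLocal v)) ∧
      ∀ᶠ v : HeightOneSpectrum (𝓞 K) in cofinite, SatakeFrobCompatibleAt ι π.1 ρ v)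
    (hB : ∀ (K : Type) [Field K] [NumberField K] (n : ℕ) (hcpt : isCompact_glFiniteIntegralLevel n K),
      0 < n → ∀ (ℓ : ℕ) [Fact ℓ.Prime] (ι : PadicAlgCl ℓ ≃+* ℂ) (ρ : FramedGaloisRep K (PadicAlgCl ℓ) n),
      ρ.toGaloisRep.IsIrreducible →
        ((∀ᶠ v : HeightOneSpectrum (𝓞 K) in cofinite, ρ.IsUnramifiedAt v) ∧
          ∀ (v : HeightOneSpectrum (𝓞 K)) (hv : ((ℓ : ℕ) : 𝓞 K) ∈ v.asIdeal),
            (Literature.NumberTheory.PAdicHodge.fontainePstAdicCompletion v ℓ hv).IsDeRhamFramed (ρ.toLocal v)) →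
        ∃ π : CuspidalAutomorphicRepData n K hcpt, π.1.IsLAlgebraic ∧
          ∀ᶠ v : HeightOneSpectrum (𝓞 K) in cofinite, SatakeFrobCompatibleAt ι π.1 ρ v)
    (hL : ∀ (K : Type) [Field K] [NumberField K] (Rec : ReciprocityData K) (n : ℕ)
      (hcpt : isCompact_glFiniteIntegralLevel n K), 0 < n → ∀ (π : CuspidalAutomorphicRepData n K hcpt),
      π.1.IsLAlgebraic → ∀ (ℓ : ℕ) [Fact ℓ.Prime] (ι : PadicAlgCl ℓ ≃+* ℂ) (ρ : FramedGaloisRep K (PadicAlgCl ℓ) n),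
      ρ.toGaloisRep.IsIrreducible →
        ((∀ᶠ v : HeightOneSpectrum (𝓞 K) in cofinite, ρ.IsUnramifiedAt v) ∧
          ∀ (v : HeightOneSpectrum (𝓞 K)) (hv : ((ℓ : ℕ) : 𝓞 K) ∈ v.asIdeal),
            (Literature.NumberTheory.PAdicHodge.fontainePstAdicCompletion v ℓ hv).IsDeRhamFramed (ρ.toLocal v)) →
        (∀ᶠ v : HeightOneSpectrum (𝓞 K) in cofinite, SatakeFrobCompatibleAt ι π.1 ρ v) →
          ∀ v : HeightOneSpectrum (𝓞 K), LocalGlobalCompatibleAt Rec ι π.1 ρ v)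
    (hJSb : JacquetShalika1981_partialPairL_boundary_repData)
    (hJSp : JacquetShalika1981_partialPairL_pole_repData)
    (hne : ∀ (K : Type) [Field K] [NumberField K], Nonempty (ReciprocityData K)) :
    _root_.Langlands := by
  -- the isobaric bootstrap, run with B_w: a pinned-geometric avatar of a cuspidal `π` is irreducible
  have irr : ∀ (K : Type) [Field K] [NumberField K] (n : ℕ) (hcpt : isCompact_glFiniteIntegralLevel n K)
      (_ : 0 < n) (π : CuspidalAutomorphicRepData n K hcpt) (ℓ : ℕ) [Fact ℓ.Prime]
      (ι : PadicAlgCl ℓ ≃+* ℂ) (ρ : FramedGaloisRep K (PadicAlgCl ℓ) n),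
      ((∀ᶠ v : HeightOneSpectrum (𝓞 K) in cofinite, ρ.IsUnramifiedAt v) ∧
        ∀ (v : HeightOneSpectrum (𝓞 K)) (hv : ((ℓ : ℕ) : 𝓞 K) ∈ v.asIdeal),
          (Literature.NumberTheory.PAdicHodge.fontainePstAdicCompletion v ℓ hv).IsDeRhamFramed
            (ρ.toLocal v)) →
      (∀ᶠ v : HeightOneSpectrum (𝓞 K) in cofinite, SatakeFrobCompatibleAt ι π.1 ρ v) →
        ρ.toGaloisRep.IsIrreducible := by
    intro K _ _ n hcpt hn π ℓ _ ι ρ hgeo hρ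
    obtain ⟨k, m, r, hr, hchar, -, hone⟩ :=
      stub_geometricConstituents stub_deRhamBlocks K ℓ n ρ hn hgeo
    by_cases hk1 : k = 1
    · exact hone hk1
    have hk0 : k ≠ 0 := by
      rintro rfl
      have h1 := hchar 1
      simp only [Finset.univ_eq_empty, Finset.prod_empty] at h1
      have hdeg : (FramedRep.charpoly ρ 1).natDegree = n := by
        simp [FramedRep.charpoly, Matrix.charpoly_natDegree_eq_dim]
      rw [h1, natDegree_one] at hdeg
      omega
    have hk2 : 2 ≤ k := by omega
    have hσ : ∀ i, ∃ σ : CuspidalAutomorphicRepData (m i) K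
        (isCompact_glFiniteIntegralLevel_holds (m i) K),
        ∀ᶠ v : HeightOneSpectrum (𝓞 K) in cofinite, SatakeFrobCompatibleAt ι σ.1 (r i) v := by
      intro i
      obtain ⟨σ, -, hcorr⟩ := hB K (m i) (isCompact_glFiniteIntegralLevel_holds (m i) K) (hr i).1 ℓ ι
        (r i) (hr i).2.1 (hr i).2.2
      exact ⟨σ, hcorr⟩
    choose σ hσc using hσ
    refine (stub_isobaricRigidity hJSb hJSp K n hcpt π k m
      (fun i => isCompact_glFiniteIntegralLevel_holds (m i) K) σ hn hk2 (fun i => (hr i).1) ?_).elim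
    have hall : ∀ᶠ v : HeightOneSpectrum (𝓞 K) in cofinite,
        ∀ i, SatakeFrobCompatibleAt ι (σ i).1 (r i) v :=
      Filter.eventually_all.mpr hσc
    filter_upwards [hρ, hall] with v hv hvi
    intro α hα
    obtain ⟨α₀, hα₀, -, hcp⟩ := hv
    obtain rfl : α = α₀ := AutomorphicRepData.hasSatakeParamAt_unique_holds π.1 hα hα₀
    choose β hβ _hurβ hcpβ using hvi
    refine ⟨β, hβ, ?_⟩
    have hprod : ρ.HasFrobCharpolyAt v (∏ i, arithFrobPolyOfSatake ι v.residueCard 1 (β i)) := by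
      intro 𝔓 h𝔓 τ hτ
      rw [hchar τ]
      exact Finset.prod_congr rfl fun i _ => hcpβ i 𝔓 h𝔓 τ hτ
    rw [← Summit.Langlands.Langlands.Theorems.IrreducibleOffSector.arithFrobPolyOfSatake_sum] at hprod
    have heq : arithFrobPolyOfSatake ι v.residueCard 1 α =
        arithFrobPolyOfSatake ι v.residueCard 1 (∑ i, β i) :=
      GaloisRep.HasFrobCharpolyAt.unique_holds
        ((FramedGaloisRep.hasFrobCharpolyAt_toGaloisRep_iff v _ ρ).mpr hcp)
        ((FramedGaloisRep.hasFrobCharpolyAt_toGaloisRep_iff v _ ρ).mpr hprod)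
    exact arithFrobPolyOfSatake_one_injective ι _ heq
  -- reciprocity up to irreducibility for EVERY `Rec`
  have hE : ∀ (F : Type) [Field F] [NumberField F] (Rec : ReciprocityData F) (n : ℕ), 0 < n →
      ∀ hcpt : isCompact_glFiniteIntegralLevel n F,
        (∀ π : CuspidalAutomorphicRepData n F hcpt, π.1.IsLAlgebraic →
          ∀ (ℓ : ℕ) [Fact ℓ.Prime] (ι : PadicAlgCl ℓ ≃+* ℂ),
            ∃ ρ : FramedGaloisRep F (PadicAlgCl ℓ) n, IsGeometricFramed Rec ρ ∧ Corresponds Rec ι π.1 ρ) ∧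
        GaloisToAutomorphic n Rec hcpt := by
    intro F _ _ Rec n hn hcpt
    refine ⟨fun π hLalg ℓ _ ι => ?_, fun ℓ _ ι ρ hirr hgeo => ?_⟩
    · obtain ⟨ρ, hgeo, hρ⟩ := hW F n hcpt hn π hLalg ℓ ι
      have hirr : ρ.toGaloisRep.IsIrreducible := irr F n hcpt hn π ℓ ι ρ hgeo hρ
      exact ⟨ρ, hgeo, hρ, hL F Rec n hcpt hn π hLalg ℓ ι ρ hirr hgeo hρ⟩
    · obtain ⟨π, hLalg, hρ⟩ := hB F n hcpt hn ℓ ι ρ hirr hgeo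
      exact ⟨π, hLalg, hρ, hL F Rec n hcpt hn π hLalg ℓ ι ρ hirr hgeo hρ⟩
  exact langlands_of_reciprocityUpToIrreducibility_forall_text_of_JS hJSb hJSp hne hE

end Summit.Langlands.Langlands.Theorems.SectorComplementSeam

end
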